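import Literature.Barriers.QuantumAdvantage.PSimFPTables
import HarnessLib

/-!
# The `p`-blocked simulator: the state stays polynomially small on every input

Topic `Literature/Barriers/QuantumAdvantage`; machine half of the proof programme for
`Literature.Barriers.QuantumAdvantage.jozsaLinden2003_pblocked` (Jozsa–Linden 2003, §3). The typed
polynomial-time framework (`Complexity/CodeFP.lean`) certifies a left fold — here the run
`runSim c w₀ gates = gates.foldl (roundSim c) (1, initBlocks c.N w₀)` of the program `PBlockedSim.lean`
— only together with a polynomial bound on the code of the accumulator along the run, *on every typed
input* (`CodeFP.foldl`, hypothesis `hG`). This file proves that bound for the simulator's state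
`(D, blocks)` in the codes `stE = pairE intE (rawE blkE)`, `blkE = pairE cfgE tabE`,
`tabE = rawE (pairE keyE zwE)` of `PSimFPTables.lean` (`cfgE` of `PSimFPBits.lean`, `zwE` of
`ZWCodeFP.lean`).
The two caps of the program are what make it true off the `p`-blocked computations: a round that
would merge more than `2p` wires is skipped, tables are indexed by `subCfgs p` (at most `4^p`
configurations) and every produced coordinate is saturated at width `W` (`capZ`).

* the invariant `StSmall p N W j (D, blocks)`: `D = 2^a` with `a ≤ j`, at most `N(j+1)` blocks, every
  block has a mask of at most `N` bits and a table of at most `4·16^p` entries whose keys have at most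
  `N` bits and whose coordinates have modulus `< 2^{W+1}` (`BlkSmall`, `EntrySmall`);
  `initBlocks_stSmall`, **`roundSim_stSmall`**, `foldl_roundSim_stSmall`;
* the code lengths under the invariant: `length_entE_le`, `length_tabE_le`, `length_blkE_le`,
  **`length_stE_le_of_stSmall`**, and the closed form
  **`length_stE_foldl_roundSim_le`**:
  `|stE (gates.foldl (roundSim ⟨p, N, W⟩) (1, initBlocks N w₀))| ≤ (672·16^p + 34)·(N + W + |gates| + 1)^3`.

## References

* R. Jozsa, N. Linden, *On the role of entanglement in quantum-computational speed-up*, Proc. R. Soc.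
  Lond. A 459 (2003) 2011–2032, arXiv:quant-ph/0201143: §3, proof of lemma `ratpbl` ((b): "at most
  `2^{p+1}` real numbers since each block has size at most `p`"), lemma `ratlemma` (the numbers of
  digits stay polynomial).
* S. Arora, B. Barak, *Computational Complexity: A Modern Approach*, CUP 2009, §1.3 (polynomially
  bounded loops).
-/

noncomputable section

namespace Literature.Barriers.QuantumAdvantage

namespace PSim

open _root_.Computability Literature.Computability.Complexity Literature.Computability.Complexity.CodeFP
  Literature.Computability.QuantumComplexity Literature.Computability.QuantumComplexity.ZWCode

/-! ### Elementary size facts about the program's operations -/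

/-- `bor` is no longer than its first argument. [folklore] -/
theorem length_bor_le_left (a b : Cfg) : (bor a b).length ≤ a.length := by
  rw [bor, List.length_zipWith]; exact min_le_left _ _

/-- `band` is no longer than its first argument. [folklore] -/
theorem length_band_le_left (a b : Cfg) : (band a b).length ≤ a.length := by
  rw [band, List.length_zipWith]; exact min_le_left _ _

/-- The merged mask of a round has at most `N` bits. [folklore] -/
theorem length_foldl_bor_le (tch : List Blk) (acc : Cfg) :
    (tch.foldl (fun acc b => bor acc b.1) acc).length ≤ acc.length := by
  induction tch generalizing acc with
  | nil => exact le_rfl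
  | cons b tch ih => exact (ih _).trans (length_bor_le_left _ _)

/-- A class mask is no longer than the merged mask. [folklore] -/
theorem length_classOf_le (C : Cfg) (splitting : List Cfg) (a : ℕ) : (classOf C splitting a).length ≤ C.length := by
  rw [classOf]
  induction splitting generalizing C with
  | nil => exact le_rfl
  | cons S spl ih =>
    rw [List.foldl_cons]
    refine (ih _).trans ?_
    split_ifs
    · exact length_band_le_left _ _
    · exact le_rfl

/-- **The enumeration lists at most `4^p` configurations.** [cite: JozsaLinden2003, §3 (proof of lemma ratpbl, (b))] -/
theorem length_subCfgs_le (p : ℕ) (m : Cfg) : (subCfgs p m).length ≤ 4 ^ p := by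
  rw [subCfgs, List.length_map, List.length_range]; exact min_le_right _ _

/-- The size of a table built by `mkTab`. [folklore] -/
theorem length_mkTab (keys : List Cfg) (f : Cfg → Cfg → ZW) : (mkTab keys f).length = keys.length * keys.length := by
  rw [mkTab, List.length_flatten, List.map_map]
  have : (List.map (List.length ∘ fun u => List.map (fun v => ((u, v), f u v)) keys) keys) =
      keys.map fun _ => keys.length := List.map_congr_left fun u _ => by simp
  rw [this, List.map_const', List.sum_replicate, smul_eq_mul]

/-- The entries of a table built by `mkTab`. [folklore] -/
theorem exists_of_mem_mkTab {keys : List Cfg} {f : Cfg → Cfg → ZW} {e : (Cfg × Cfg) × ZW} (h : e ∈ mkTab keys f) :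
    ∃ u ∈ keys, ∃ v ∈ keys, e = ((u, v), f u v) := by
  simp only [mkTab, List.mem_flatten, List.mem_map] at h
  obtain ⟨row, ⟨u, hu, rfl⟩, he⟩ := h
  obtain ⟨v, hv, rfl⟩ := List.mem_map.1 he
  exact ⟨u, hu, v, hv, rfl⟩

/-- **Saturated coordinates have modulus `< 2^W`.** [folklore] -/
theorem natAbs_capZ_lt (W : ℕ) (z : ZW) (k : Fin 4) : ((capZ W z) k).natAbs < 2 ^ W := by
  simp only [capZ]
  split_ifs with h
  · exact h
  · simp

/-- `dedupL` does not lengthen a list. [folklore] -/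
theorem length_dedupL_le (l : List Cfg) : (dedupL l).length ≤ l.length := by
  rw [dedupL]
  suffices h : ∀ acc : List Cfg,
      (l.foldl (fun acc a => if a ∈ acc then acc else acc ++ [a]) acc).length ≤ acc.length + l.length by
    simpa using h []
  induction l with
  | nil => intro acc; simp
  | cons a l ih =>
    intro acc
    rw [List.foldl_cons]
    refine (ih _).trans ?_
    split_ifs
    · simp
    · simp; omega

/-- The members of `dedupL l` are members of `l`. [folklore] -/
theorem mem_of_mem_dedupL {l : List Cfg} {a : Cfg} (h : a ∈ dedupL l) : a ∈ l := by
  rw [dedupL] at h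
  suffices hs : ∀ acc : List Cfg,
      a ∈ l.foldl (fun acc a => if a ∈ acc then acc else acc ++ [a]) acc → a ∈ acc ∨ a ∈ l by
    simpa using hs [] h
  clear h
  induction l with
  | nil => intro acc h; exact Or.inl h
  | cons b l ih =>
    intro acc h
    rw [List.foldl_cons] at h
    rcases ih _ h with h' | h'
    · split_ifs at h' with hb
      · exact Or.inl h'
      · rcases List.mem_append.1 h' with h'' | h''
        · exact Or.inl h''
        · exact Or.inr (by rw [List.mem_singleton.1 h'']; exact List.mem_cons_self)
    · exact Or.inr (List.mem_cons_of_mem _ h')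

/-! ### The invariant -/

/-- A small table entry: keys of at most `N` bits, coordinates of modulus `< 2^{W+1}`. [folklore] -/
structure EntrySmall (N W : ℕ) (e : (Cfg × Cfg) × ZW) : Prop where
  /-- the row key has at most `N` bits -/
  fst_le : e.1.1.length ≤ N
  /-- the column key has at most `N` bits -/
  snd_le : e.1.2.length ≤ N
  /-- the coordinates are saturated -/
  natAbs_lt : ∀ k, (e.2 k).natAbs < 2 ^ (W + 1)

/-- A small block: a mask of at most `N` bits and a table of at most `4·16^p` small entries.
[cite: JozsaLinden2003, §3 (proof of lemma ratpbl, (b))] -/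
structure BlkSmall (p N W : ℕ) (b : Blk) : Prop where
  /-- the mask has at most `N` bits -/
  mask_le : b.1.length ≤ N
  /-- the table has at most `4·16^p` entries -/
  tab_le : b.2.length ≤ 4 * 16 ^ p
  /-- all entries are small -/
  small : ∀ e ∈ b.2, EntrySmall N W e

/-- A small state after `j` rounds: `D = 2^a` with `a ≤ j`, at most `N(j+1)` blocks, all small. [folklore] -/
structure StSmall (p N W j : ℕ) (st : ℤ × List Blk) : Prop where
  /-- the scale is a power of two of exponent at most `j` -/
  scale : ∃ a ≤ j, st.1 = 2 ^ a
  /-- at most `N(j+1)` blocks -/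
  count : st.2.length ≤ N * (j + 1)
  /-- all blocks are small -/
  small : ∀ b ∈ st.2, BlkSmall p N W b

/-- The invariant is monotone in the round count. [folklore] -/
theorem StSmall.mono {p N W j j' : ℕ} {st : ℤ × List Blk} (h : StSmall p N W j st) (hj : j ≤ j') :
    StSmall p N W j' st := by
  obtain ⟨⟨a, ha, hD⟩, hc, hs⟩ := h
  exact ⟨⟨a, ha.trans hj, hD⟩, hc.trans (Nat.mul_le_mul_left _ (by omega)), hs⟩

/-- A table built over the enumeration of a short mask with saturated values is small. [folklore] -/
theorem blkSmall_mkTab {p N W : ℕ} {A : Cfg} (hA : A.length ≤ N) (g : Cfg → Cfg → ZW) :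
    BlkSmall p N W (A, mkTab (subCfgs p A) fun u v => capZ W (g u v)) := by
  refine ⟨hA, ?_, fun e he => ?_⟩
  · change (mkTab (subCfgs p A) fun u v => capZ W (g u v)).length ≤ 4 * 16 ^ p
    rw [length_mkTab]
    have h4 := length_subCfgs_le p A
    calc (subCfgs p A).length * (subCfgs p A).length ≤ 4 ^ p * 4 ^ p := Nat.mul_le_mul h4 h4
      _ = 16 ^ p := by rw [← mul_pow]; norm_num
      _ ≤ 4 * 16 ^ p := Nat.le_mul_of_pos_left _ (by norm_num)
  · obtain ⟨u, hu, v, hv, rfl⟩ := exists_of_mem_mkTab he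
    exact ⟨(length_of_mem_subCfgs hu).le.trans hA, (length_of_mem_subCfgs hv).le.trans hA,
      fun k => (natAbs_capZ_lt W _ k).trans_le (Nat.pow_le_pow_right two_pos (Nat.le_succ W))⟩

/-- Doubling keeps a block small. [folklore] -/
theorem blkSmall_doubleTab {p N W : ℕ} {b : Blk} (h : BlkSmall p N W b) : BlkSmall p N W (b.1, doubleTab W b.2) := by
  refine ⟨h.mask_le, ?_, fun e he => ?_⟩
  · change (doubleTab W b.2).length ≤ _
    rw [doubleTab, List.length_map]; exact h.tab_le
  · change e ∈ b.2.map _ at he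
    obtain ⟨e₀, he₀, rfl⟩ := List.mem_map.1 he
    exact ⟨(h.small e₀ he₀).fst_le, (h.small e₀ he₀).snd_le,
      fun k => (natAbs_capZ_lt W _ k).trans_le (Nat.pow_le_pow_right two_pos (Nat.le_succ W))⟩

/-- **The new blocks of a round are at most `N` and all small.** [cite: JozsaLinden2003, §3 (proof of lemma ratpbl, Case 2)] -/
theorem newBlocks_small {p N W : ℕ} {C : Cfg} (hC : C.length ≤ N) (keys : List Cfg) (T : Tab) :
    (newBlocks p N W C keys T).length ≤ N ∧ ∀ b ∈ newBlocks p N W C keys T, BlkSmall p N W b := by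
  simp only [newBlocks]
  constructor
  · rw [List.length_map]
    refine (length_dedupL_le _).trans ?_
    rw [List.length_map]
    exact (List.length_filter_le _ _).trans (by rw [List.length_range])
  · intro b hb
    obtain ⟨A, hA, rfl⟩ := List.mem_map.1 hb
    obtain ⟨a, -, rfl⟩ := List.mem_map.1 (mem_of_mem_dedupL hA)
    exact blkSmall_mkTab ((length_classOf_le _ _ _).trans hC) _

/-- **The initial state is small.** [folklore] -/
theorem initBlocks_stSmall (p N W : ℕ) (w₀ : Cfg) : StSmall p N W 0 (1, initBlocks N w₀) := by
  refine ⟨⟨0, le_rfl, rfl⟩, by simp [initBlocks], fun b hb => ?_⟩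
  simp only [initBlocks, List.mem_map, List.mem_range] at hb
  obtain ⟨i, -, rfl⟩ := hb
  refine ⟨by simp [oneHot], ?_, fun e he => ?_⟩
  · rw [length_mkTab]
    simp only [List.length_cons, List.length_nil]
    exact le_mul_of_one_le_right (by norm_num) (Nat.one_le_pow _ _ (by norm_num))
  · obtain ⟨u, hu, v, hv, rfl⟩ := exists_of_mem_mkTab he
    have hkey : ∀ w ∈ [zeros N, oneHot N i], w.length ≤ N := by
      intro w hw
      simp only [List.mem_cons, List.mem_nil_iff, or_false] at hw
      rcases hw with rfl | rfl <;> simp [zeros, oneHot]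
    refine ⟨hkey u hu, hkey v hv, fun k => ?_⟩
    have h2 : (1 : ℕ) < 2 ^ (W + 1) := Nat.one_lt_two_pow (Nat.succ_ne_zero W)
    have hone : ∀ k : Fin 4, ((ZW.one : ZW) k).natAbs ≤ 1 := by
      intro k; fin_cases k <;> simp [ZW.one]
    dsimp only
    split_ifs
    · exact (hone k).trans_lt h2
    · simp

/-- **One round keeps the state small** (on every input: junk rounds leave the state unchanged, the
processed ones replace the touching blocks by at most `N` small blocks and at most double `D`). [cite: JozsaLinden2003, §3 (proof of lemma ratpbl, Cases 1 and 2)] -/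
theorem roundSim_stSmall {p N W j : ℕ} {st : ℤ × List Blk} (h : StSmall p N W j st) (g : ℕ × ℕ × ℕ) :
    StSmall p N W (j + 1) (roundSim ⟨p, N, W⟩ st g) := by
  obtain ⟨D, blocks⟩ := st
  obtain ⟨op, i, jw⟩ := g
  simp only [roundSim]
  set tch := touchingL op i jw blocks with htch
  set rest := untouchedL op i jw blocks with hrest
  set C := tch.foldl (fun acc b => bor acc b.1) (zeros N) with hCdef
  by_cases hcond : (tch.length = 1 ∨ tch.length = 2) ∧ popcount C ≤ 2 * p
  · rw [if_pos hcond]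
    obtain ⟨⟨a, ha, hD⟩, hc, hs⟩ := h
    simp only at hD hc hs
    have hC : C.length ≤ N := (length_foldl_bor_le _ _).trans (by simp [zeros])
    have hnew := fun T : Tab => newBlocks_small (p := p) (W := W) hC (subCfgs p C) T
    have hrest_sub : ∀ b ∈ rest, b ∈ blocks := fun b hb => List.mem_of_mem_filter hb
    refine ⟨?_, ?_, ?_⟩
    · by_cases hop : op = 0
      · refine ⟨a + 1, by omega, ?_⟩
        simp only [hop, if_true, hD]
        ring
      · exact ⟨a, by omega, by simp only [hop, if_false, hD]⟩
    · simp only [List.length_append]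
      have hrest : (if op = 0 then rest.map (fun b => (b.1, doubleTab W b.2)) else rest).length ≤ blocks.length := by
        split_ifs
        · rw [List.length_map]; exact List.length_filter_le _ _
        · exact List.length_filter_le _ _
      calc _ ≤ blocks.length + N := Nat.add_le_add hrest (hnew _).1
        _ ≤ N * (j + 1) + N := Nat.add_le_add_right hc _
        _ = N * (j + 1 + 1) := by ring
    · intro b hb
      rcases List.mem_append.1 hb with hb | hb
      · by_cases hop : op = 0
        · rw [if_pos hop] at hb
          obtain ⟨b₀, hb₀, rfl⟩ := List.mem_map.1 hb
          exact blkSmall_doubleTab (hs b₀ (hrest_sub b₀ hb₀))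
        · rw [if_neg hop] at hb
          exact hs b (hrest_sub b hb)
      · exact (hnew _).2 b hb
  · rw [if_neg hcond]
    exact h.mono (Nat.le_succ j)

/-- **The state stays small along the whole run.** [folklore] -/
theorem foldl_roundSim_stSmall (p N W : ℕ) (w₀ : Cfg) (gates : List (ℕ × ℕ × ℕ)) :
    StSmall p N W gates.length (gates.foldl (roundSim ⟨p, N, W⟩) (1, initBlocks N w₀)) := by
  induction gates using List.reverseRecOn with
  | nil => exact initBlocks_stSmall p N W w₀
  | append_singleton gs g ih =>
    rw [List.foldl_append, List.foldl_cons, List.foldl_nil, List.length_append, List.length_singleton]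
    exact roundSim_stSmall ih g

/-! ### Code lengths under the invariant -/

/-- The code of a small entry. [folklore] -/
theorem length_entE_le {N W : ℕ} {e : (Cfg × Cfg) × ZW} (h : EntrySmall N W e) :
    (entE e).length ≤ 24 * N + 14 * W + 40 := by
  obtain ⟨⟨u, v⟩, z⟩ := e
  have hz : (enc z).length ≤ 14 * (W + 1) + 20 := length_enc_le h.natAbs_lt
  have hu : u.length ≤ N := h.fst_le
  have hv : v.length ≤ N := h.snd_le
  simp only [entE, keyE, pairE_apply, length_boolPair, length_cfgE, zwE]
  omega

/-- The code of a small table. [folklore] -/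
theorem length_tabE_le {p N W : ℕ} {b : Blk} (h : BlkSmall p N W b) :
    (tabE b.2).length ≤ 4 * 16 ^ p * (48 * N + 28 * W + 82) := by
  rw [tabE, length_rawE]
  calc (b.2.map fun e => 2 * (entE e).length + 2).sum
      ≤ (b.2.map fun e => 2 * (entE e).length + 2).length • (48 * N + 28 * W + 82) :=
        List.sum_le_card_nsmul _ _ fun x hx => by
          obtain ⟨e, he, rfl⟩ := List.mem_map.1 hx
          have := length_entE_le (h.small e he)
          omega
    _ ≤ 4 * 16 ^ p * (48 * N + 28 * W + 82) := by
        rw [List.length_map, smul_eq_mul]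
        exact Nat.mul_le_mul_right _ h.tab_le

/-- The code of a small block. [folklore] -/
theorem length_blkE_le {p N W : ℕ} {b : Blk} (h : BlkSmall p N W b) :
    (blkE b).length ≤ 8 * N + 2 + 4 * 16 ^ p * (48 * N + 28 * W + 82) := by
  have ht := length_tabE_le h
  have hm := h.mask_le
  rw [blkE, pairE_apply, length_boolPair, length_cfgE]
  omega

/-- The code of `2^a`. [folklore] -/
theorem length_intE_two_pow_le (a : ℕ) : (intE ((2 : ℤ) ^ a)).length ≤ 3 * a + 5 := by
  have h := Brick.length_dpEnc_le ((2 : ℤ) ^ a)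
  have hs : ((2 : ℤ) ^ a).natAbs.size = a + 1 := by
    rw [Int.natAbs_pow, show (2 : ℤ).natAbs = 2 from rfl, Nat.size_pow]
  rw [hs] at h
  simpa [intE, mul_add] using h

/-- **The code of a small state.** [folklore] -/
theorem length_stE_le_of_stSmall {p N W j : ℕ} {st : ℤ × List Blk} (h : StSmall p N W j st) :
    (stE st).length ≤ 6 * j + 12 + N * (j + 1) * (2 * (8 * N + 2 + 4 * 16 ^ p * (48 * N + 28 * W + 82)) + 2) := by
  obtain ⟨D, blocks⟩ := st
  obtain ⟨⟨a, ha, hD⟩, hc, hs⟩ := h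
  simp only at hD hc hs
  subst hD
  have hDl := length_intE_two_pow_le a
  have hbl : (rawE blkE blocks).length ≤ N * (j + 1) * (2 * (8 * N + 2 + 4 * 16 ^ p * (48 * N + 28 * W + 82)) + 2) := by
    rw [length_rawE]
    calc (blocks.map fun b => 2 * (blkE b).length + 2).sum
        ≤ (blocks.map fun b => 2 * (blkE b).length + 2).length •
            (2 * (8 * N + 2 + 4 * 16 ^ p * (48 * N + 28 * W + 82)) + 2) :=
          List.sum_le_card_nsmul _ _ fun x hx => by
            obtain ⟨b, hb, rfl⟩ := List.mem_map.1 hx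
            have := length_blkE_le (hs b hb)
            omega
      _ ≤ _ := by
          rw [List.length_map, smul_eq_mul]
          exact Nat.mul_le_mul_right _ hc
  rw [stE, pairE_apply, length_boolPair]
  dsimp only
  omega

/-- **The closed form: the state of the run is cubically bounded in `N + W + (number of rounds)`,
with a coefficient depending on the block bound `p` only.** This is the hypothesis `hG` of
`CodeFP.foldl` for the run of the simulator. [cite: JozsaLinden2003, §3 (lemma ratlemma, proof of lemma ratpbl: "poly(j) elementary computational steps")] -/
theorem length_stE_foldl_roundSim_le (p N W : ℕ) (w₀ : Cfg) (gates : List (ℕ × ℕ × ℕ)) :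
    (stE (gates.foldl (roundSim ⟨p, N, W⟩) (1, initBlocks N w₀))).length ≤
      (672 * 16 ^ p + 34) * (N + W + gates.length + 1) ^ 3 := by
  have h := length_stE_le_of_stSmall (foldl_roundSim_stSmall p N W w₀ gates)
  set j := gates.length
  set K := 16 ^ p
  set n := N + W + j with hn
  have hN : N ≤ n := by omega
  have hW : W ≤ n := by omega
  have hj : j ≤ n := by omega
  refine h.trans ?_
  have hA : 4 * K * (48 * N + 28 * W + 82) ≤ 328 * K * (n + 1) := by
    have h1 := Nat.mul_le_mul_left K hN
    have h2 := Nat.mul_le_mul_left K hW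
    have e1 : 4 * K * (48 * N + 28 * W + 82) = 192 * (K * N) + 112 * (K * W) + 328 * K := by ring
    have e2 : 328 * K * (n + 1) = 328 * (K * n) + 328 * K := by ring
    omega
  have hP : 2 * (8 * N + 2 + 4 * K * (48 * N + 28 * W + 82)) + 2 ≤ (656 * K + 22) * (n + 1) := by
    have e : (656 * K + 22) * (n + 1) = 2 * (328 * K * (n + 1)) + 22 * n + 22 := by ring
    omega
  have hM : N * (j + 1) ≤ (n + 1) * (n + 1) := Nat.mul_le_mul (by omega) (by omega)
  have hMP := Nat.mul_le_mul hM hP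
  have e3 : (n + 1) * (n + 1) * ((656 * K + 22) * (n + 1)) = (656 * K + 22) * (n + 1) ^ 3 := by ring
  have hcube : n + 1 ≤ (n + 1) ^ 3 := Nat.le_self_pow (by norm_num) _
  have h5 : 6 * j + 12 ≤ (16 * K + 12) * (n + 1) ^ 3 :=
    calc 6 * j + 12 ≤ 12 * (n + 1) := by omega
      _ ≤ 12 * (n + 1) ^ 3 := Nat.mul_le_mul_left _ hcube
      _ ≤ (16 * K + 12) * (n + 1) ^ 3 := Nat.mul_le_mul_right _ (by omega)
  calc 6 * j + 12 + N * (j + 1) * (2 * (8 * N + 2 + 4 * K * (48 * N + 28 * W + 82)) + 2)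
      ≤ (16 * K + 12) * (n + 1) ^ 3 + (656 * K + 22) * (n + 1) ^ 3 := Nat.add_le_add h5 (hMP.trans_eq e3)
    _ = (672 * K + 34) * (n + 1) ^ 3 := by ring

end PSim

end Literature.Barriers.QuantumAdvantage

end
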